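import Literature.AlgebraicGeometry.Resolution.PointBlowupPolygonLawsU2Indexed
import Literature.AlgebraicGeometry.Resolution.PointBlowupPolygonLawsIndexed
import HarnessLib

/-!
# (K-Φ3) label propagation VII: the KEEP budget along a chain of labelled frames (idea-1's assembly (T6 minus F3), verbatim)

Cell `res-dim4-pi` (D-0157 DOOR 2), Φ = β_h line of res-dim4-idea-1. This file lands VERBATIM the two sorry-free assembly theorems of the
signature sketch `pub/res-dim4/res-dim4-idea-1/lean-g5/Sketch.lean` (sha16 ade7af20c994a8b6, idea-1 g5, desk WORD #114 (a) / #121 (b);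
«I do not propose» — landed by the prover seat p-11 under DR-157-C): along a chain of regular local rings `R k` (dimension `2 + 2`) with
ring maps `φ k`, ARRIVAL frames `a k`, STEP frames `s k`, ideals `J k ⊆ 𝔪^μ` and a KEEP/LOSE predicate, the one-step polygon laws of the
tree (`WeightedOrder.betaS_colon_u2_lt` — KEEP-h, pivot `u₂`, needs `αs < L`; `WeightedOrder.betaS_colon_le` — LOSE-h, pivot `u₁`) give

* **`keepCount_add_betaS_le`** — `#{KEEP steps in [k₀, k₀+n)} + βs(a (k₀+n)) ≤ βs(a k₀)`;
* **`keepCount_le_betaS`** — hence the KEEP steps after `k₀` number at most `βs(a k₀)` (the input `hbudget` of p-5's dock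
  `ResCone.no_tail_of_keepCount_le'`, `…ResConeKeepBudget`, p689278);
* (OURS) `keepCount_add_betaS_le_of_betaS_le`, `keepCount_le_betaS_of_betaS_le` — the same for every `r`, with the ideal equality
  `J (k+1) = weak transform` weakened to `βs(a (k+1), J (k+1)) ≤ βs(a (k+1), weak transform)` (room for cleaning/unit factors, FILE V).

The binders `hgens`/`hne`/`hδ`/`hsa` relating the step frame to the arrival frame are (K-Φ3) = FILES I–VI of this seat
(`…PhiLineVertexPerturbation`, `…FrameMoves` — twist and dissolution, `hsa` with equality —, `…LabelForm`, `…DeltaLabel`, `…CleaningBlind`,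
`…LinearLabel`); `hα` is (K-Φ1) (`PhiLine.alphaS_lt_of_isIsolated`, p689600); `hkeep`/`hlose` are the chain dictionary (K-Φ2). Statements
and proofs below are idea-1 g5's, character for character (only this docstring and the imports — the two polygon-law files instead of the
sketch's cell imports — differ). [OURS · CANDIDATE architecture · counted 0 · AI work weaker than expert review.] Nothing here proves K2(p),
`NoAboveFloorTrap`, the β_h line, or resolution of singularities in dimension ≥ 4 / characteristic p.

Sources: V. Cossart, U. Jannsen, S. Saito, LNM **2270** (2020), Lemma 12.1 (3), Lemma 12.2 (3)/(5), Lemma 13.4 (3) [`CossartJannsenSaito2020`];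
V. Cossart, O. Piltant, J. Algebra 320 (2008), (16) and proof of Lemma 4.5 [`CossartPiltant2008`].
-/

noncomputable section

open MvPolynomial IsLocalRing
open Literature.AlgebraicGeometry.Resolution
open Literature.AlgebraicGeometry.Resolution.WeightedOrder

set_option linter.dupNamespace false

namespace Summit.ResolutionOfSingularities.ResolutionOfSingularities.Theorems.PIDim4.PhiLine

universe u

/-! ## (T6 minus F3) the KEEP budget: along a chain of adapted labels, #KEEP-h steps + βs(end) ≤ βs(start)

Pure `WeightedOrder` dress, PROVED from the tree's laws `betaS_colon_u2_lt` (KEEP-h, pivot `u₂`, needs `αs < L`) and `betaS_colon_le`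
(LOSE-h, pivot `u₁`).  At each state `k` there are TWO frames: the ARRIVAL frame `a k` (transported from the previous step) and the STEP
frame `s k` (re-adapted / twisted by `u2Shear` / new `u₂`, chosen for the step from `k`), related only by `hsa : βs (s k) ≤ βs (a k)` —
this inequality, and the label hypotheses `hne`/`hδ` on `s k`, are (K-Φ3) = LABEL PROPAGATION, the located price (for linear re-choices
of `u₂` and `u₁`-only re-adaptation `v` is unchanged; the twist needs `PolygonShearIndexed`; the bad case is `v = (0,2)` solvable). -/

/-- **KEEP budget, additive form (idea-1 g5 Sketch, verbatim):** along the chain, `#{i < n : keep (k₀ + i)} + βs(a (k₀ + n)) ≤ βs(a k₀)` —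
each KEEP-h step costs at least one scaled unit of `β` (`betaS_colon_u2_lt`, CJS Lemma 12.2 (5) / 13.4 (3)), no LOSE-h step increases it
(`betaS_colon_le`, CJS Lemma 12.1 (3)), and `βs(s k) ≤ βs(a k)` (`hsa`). [cite: CossartJannsenSaito2020, Lemma 13.4 (3)]
[cite: CossartPiltant2008, (16)] -/
theorem keepCount_add_betaS_le {R : ℕ → Type u} [∀ k, CommRing (R k)] [∀ k, IsRegularLocalRing (R k)]
    (φ : ∀ k, R k →+* R (k + 1)) (a s : ∀ k, Fin (2 + 2) → R k) (J : ∀ k, Ideal (R k)) (μ : ℕ)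
    (keep : ℕ → Prop) [DecidablePred keep]
    (hgena : ∀ k, Ideal.span (Set.range (a k)) = maximalIdeal (R k))
    (hgens : ∀ k, Ideal.span (Set.range (s k)) = maximalIdeal (R k)) (hdim : ∀ k, ringKrullDim (R k) = (2 : ℕ) + 2)
    (hJ : ∀ k, J k ≤ maximalIdeal (R k) ^ μ) (hne : ∀ k, (pts (s k) (J k) μ).Nonempty)
    (hδ : ∀ k, μ.factorial < deltaS (s k) (J k) μ)
    (hsa : ∀ k, betaS (s k) (J k) μ ≤ betaS (a k) (J k) μ)
    (hα : ∀ k, keep k → alphaS (s k) (J k) μ < μ.factorial)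
    (hkeep : ∀ k, keep k → a (k + 1) (u2 2) = φ k (s k (u2 2)) ∧ (∀ i, i ≠ u2 2 → φ k (s k i) = φ k (s k (u2 2)) * a (k + 1) i)
      ∧ J (k + 1) = (Ideal.map (φ k) (J k)).colon {φ k (s k (u2 2)) ^ μ})
    (hlose : ∀ k, ¬ keep k → a (k + 1) (u1 2) = φ k (s k (u1 2)) ∧ (∀ i, i ≠ u1 2 → φ k (s k i) = φ k (s k (u1 2)) * a (k + 1) i)
      ∧ J (k + 1) = (Ideal.map (φ k) (J k)).colon {φ k (s k (u1 2)) ^ μ})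
    (k₀ n : ℕ) :
    ((Finset.range n).filter (fun i => keep (k₀ + i))).card + betaS (a (k₀ + n)) (J (k₀ + n)) μ ≤ betaS (a k₀) (J k₀) μ := by
  induction n with
  | zero => simp
  | succ n ih =>
    -- one step from `k₀ + n` to `k₀ + n + 1`, taken in the STEP frame `s (k₀ + n)`
    have hstep : (if keep (k₀ + n) then 1 else 0) + betaS (a (k₀ + n + 1)) (J (k₀ + n + 1)) μ ≤
        betaS (s (k₀ + n)) (J (k₀ + n)) μ := by
      by_cases hk : keep (k₀ + n)
      · obtain ⟨hpiv, hoth, hJ'⟩ := hkeep _ hk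
        have := betaS_colon_u2_lt (φ (k₀ + n)) hpiv hoth (hgens _) (hdim _) (hgena _) (hdim _) (hJ _) (hne _) (hδ _) (hα _ hk)
        rw [← hJ'] at this
        simp [hk]; omega
      · obtain ⟨hpiv, hoth, hJ'⟩ := hlose _ hk
        have := betaS_colon_le (φ (k₀ + n)) hpiv hoth (hgens _) (hdim _) (hgena _) (hdim _) (hJ _) (hne _) (hδ _)
        rw [← hJ'] at this
        simp [hk]; omega
    have hsa' := hsa (k₀ + n)
    have hcard : ((Finset.range (n + 1)).filter (fun i => keep (k₀ + i))).card =
        ((Finset.range n).filter (fun i => keep (k₀ + i))).card + (if keep (k₀ + n) then 1 else 0) := by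
      rw [Finset.range_add_one, Finset.filter_insert]
      split_ifs with hk
      · rw [Finset.card_insert_of_notMem (by simp)]
      · simp
    have h3 : k₀ + (n + 1) = k₀ + n + 1 := by ring
    rw [h3, hcard]
    omega

/-- **Corollary (the lossy-tail lemma of WORD #114 (a), minus F3):** on such a chain the KEEP-h steps after `k₀` number at most
`betaS (a k₀) (J k₀) μ`; in particular they are NOT cofinal, so a B∞ tail is eventually an all-`Q` run of LOSE-h steps, which (from its
second step on) is a FREE tail (`¬ FreeTail.IsSatellite`: it loses the letter born at the previous step) — excluded along all-isolated
chains by `FreeTailProof.noIsolatedFreeTailAt_self`. -/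
theorem keepCount_le_betaS {R : ℕ → Type u} [∀ k, CommRing (R k)] [∀ k, IsRegularLocalRing (R k)]
    (φ : ∀ k, R k →+* R (k + 1)) (a s : ∀ k, Fin (2 + 2) → R k) (J : ∀ k, Ideal (R k)) (μ : ℕ)
    (keep : ℕ → Prop) [DecidablePred keep]
    (hgena : ∀ k, Ideal.span (Set.range (a k)) = maximalIdeal (R k))
    (hgens : ∀ k, Ideal.span (Set.range (s k)) = maximalIdeal (R k)) (hdim : ∀ k, ringKrullDim (R k) = (2 : ℕ) + 2)
    (hJ : ∀ k, J k ≤ maximalIdeal (R k) ^ μ) (hne : ∀ k, (pts (s k) (J k) μ).Nonempty)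
    (hδ : ∀ k, μ.factorial < deltaS (s k) (J k) μ)
    (hsa : ∀ k, betaS (s k) (J k) μ ≤ betaS (a k) (J k) μ)
    (hα : ∀ k, keep k → alphaS (s k) (J k) μ < μ.factorial)
    (hkeep : ∀ k, keep k → a (k + 1) (u2 2) = φ k (s k (u2 2)) ∧ (∀ i, i ≠ u2 2 → φ k (s k i) = φ k (s k (u2 2)) * a (k + 1) i)
      ∧ J (k + 1) = (Ideal.map (φ k) (J k)).colon {φ k (s k (u2 2)) ^ μ})
    (hlose : ∀ k, ¬ keep k → a (k + 1) (u1 2) = φ k (s k (u1 2)) ∧ (∀ i, i ≠ u1 2 → φ k (s k i) = φ k (s k (u1 2)) * a (k + 1) i)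
      ∧ J (k + 1) = (Ideal.map (φ k) (J k)).colon {φ k (s k (u1 2)) ^ μ})
    (k₀ n : ℕ) :
    ((Finset.range n).filter (fun i => keep (k₀ + i))).card ≤ betaS (a k₀) (J k₀) μ :=
  le_of_add_le_left (keepCount_add_betaS_le φ a s J μ keep hgena hgens hdim hJ hne hδ hsa hα hkeep hlose k₀ n)


/-! ## (OURS, p-11 g4) The same budget with the ideal equality weakened to a `β`-comparison — room for CLEANING and UNIT factors

Along the tree's chains the next residual is `G′ = ε·H + R̃` (unit `ε`, cleaning correction `R̃ ∈ (u₁′)^d`), not the weak transform `(H) =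
(J R′ : u^μ)` itself; by `PhiLine.betaS_eq_of_cleaning` (FILE V) the two have the same `β` in the arrival frame whenever `α < 1`. So the
assembly is restated with the third conjunct of `hkeep`/`hlose` replaced by `βs(a (k+1), J (k+1)) ≤ βs(a (k+1), weak transform)`, and
for EVERY `r` (frames `Fin (r + 2)`, `ringKrullDim = r + 2`). Proof = idea-1's, with `≤` chained instead of `rw`. -/

/-- **KEEP budget with comparison binders (every `r`).** As `keepCount_add_betaS_le`, but `hkeep`/`hlose` only ask
`betaS (a (k+1)) (J (k+1)) μ ≤ betaS (a (k+1)) ((J k).map (φ k)).colon {φ k (s k u)^μ}) μ` (`u` the pivot) instead of the equality of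
ideals — satisfied with equality by the weak transform and, by FILE V, by the cleaned residual. [cite: CossartJannsenSaito2020, Lemma 13.4 (3)]
[cite: CossartPiltant2008, (16)] -/
theorem keepCount_add_betaS_le_of_betaS_le {r : ℕ} {R : ℕ → Type u} [∀ k, CommRing (R k)] [∀ k, IsRegularLocalRing (R k)]
    (φ : ∀ k, R k →+* R (k + 1)) (a s : ∀ k, Fin (r + 2) → R k) (J : ∀ k, Ideal (R k)) (μ : ℕ)
    (keep : ℕ → Prop) [DecidablePred keep]
    (hgena : ∀ k, Ideal.span (Set.range (a k)) = maximalIdeal (R k))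
    (hgens : ∀ k, Ideal.span (Set.range (s k)) = maximalIdeal (R k)) (hdim : ∀ k, ringKrullDim (R k) = r + 2)
    (hJ : ∀ k, J k ≤ maximalIdeal (R k) ^ μ) (hne : ∀ k, (pts (s k) (J k) μ).Nonempty)
    (hδ : ∀ k, μ.factorial < deltaS (s k) (J k) μ)
    (hsa : ∀ k, betaS (s k) (J k) μ ≤ betaS (a k) (J k) μ)
    (hα : ∀ k, keep k → alphaS (s k) (J k) μ < μ.factorial)
    (hkeep : ∀ k, keep k → a (k + 1) (u2 r) = φ k (s k (u2 r)) ∧ (∀ i, i ≠ u2 r → φ k (s k i) = φ k (s k (u2 r)) * a (k + 1) i)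
      ∧ betaS (a (k + 1)) (J (k + 1)) μ ≤ betaS (a (k + 1)) ((Ideal.map (φ k) (J k)).colon {φ k (s k (u2 r)) ^ μ}) μ)
    (hlose : ∀ k, ¬ keep k → a (k + 1) (u1 r) = φ k (s k (u1 r)) ∧ (∀ i, i ≠ u1 r → φ k (s k i) = φ k (s k (u1 r)) * a (k + 1) i)
      ∧ betaS (a (k + 1)) (J (k + 1)) μ ≤ betaS (a (k + 1)) ((Ideal.map (φ k) (J k)).colon {φ k (s k (u1 r)) ^ μ}) μ)
    (k₀ n : ℕ) :
    ((Finset.range n).filter (fun i => keep (k₀ + i))).card + betaS (a (k₀ + n)) (J (k₀ + n)) μ ≤ betaS (a k₀) (J k₀) μ := by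
  induction n with
  | zero => simp
  | succ n ih =>
    have hstep : (if keep (k₀ + n) then 1 else 0) + betaS (a (k₀ + n + 1)) (J (k₀ + n + 1)) μ ≤
        betaS (s (k₀ + n)) (J (k₀ + n)) μ := by
      by_cases hk : keep (k₀ + n)
      · obtain ⟨hpiv, hoth, hJ'⟩ := hkeep _ hk
        have := betaS_colon_u2_lt (φ (k₀ + n)) hpiv hoth (hgens _) (hdim _) (hgena _) (hdim _) (hJ _) (hne _) (hδ _) (hα _ hk)
        simp [hk]; omega
      · obtain ⟨hpiv, hoth, hJ'⟩ := hlose _ hk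
        have := betaS_colon_le (φ (k₀ + n)) hpiv hoth (hgens _) (hdim _) (hgena _) (hdim _) (hJ _) (hne _) (hδ _)
        simp [hk]; omega
    have hsa' := hsa (k₀ + n)
    have hcard : ((Finset.range (n + 1)).filter (fun i => keep (k₀ + i))).card =
        ((Finset.range n).filter (fun i => keep (k₀ + i))).card + (if keep (k₀ + n) then 1 else 0) := by
      rw [Finset.range_add_one, Finset.filter_insert]
      split_ifs with hk
      · rw [Finset.card_insert_of_notMem (by simp)]
      · simp
    have h3 : k₀ + (n + 1) = k₀ + n + 1 := by ring
    rw [h3, hcard]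
    omega

/-- **KEEP budget with comparison binders, counted form (every `r`):** the KEEP steps after `k₀` number at most `βs(a k₀, J k₀)`.
[cite: CossartJannsenSaito2020, Lemma 13.4 (3)] [cite: CossartPiltant2008, (16)] -/
theorem keepCount_le_betaS_of_betaS_le {r : ℕ} {R : ℕ → Type u} [∀ k, CommRing (R k)] [∀ k, IsRegularLocalRing (R k)]
    (φ : ∀ k, R k →+* R (k + 1)) (a s : ∀ k, Fin (r + 2) → R k) (J : ∀ k, Ideal (R k)) (μ : ℕ)
    (keep : ℕ → Prop) [DecidablePred keep]
    (hgena : ∀ k, Ideal.span (Set.range (a k)) = maximalIdeal (R k))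
    (hgens : ∀ k, Ideal.span (Set.range (s k)) = maximalIdeal (R k)) (hdim : ∀ k, ringKrullDim (R k) = r + 2)
    (hJ : ∀ k, J k ≤ maximalIdeal (R k) ^ μ) (hne : ∀ k, (pts (s k) (J k) μ).Nonempty)
    (hδ : ∀ k, μ.factorial < deltaS (s k) (J k) μ)
    (hsa : ∀ k, betaS (s k) (J k) μ ≤ betaS (a k) (J k) μ)
    (hα : ∀ k, keep k → alphaS (s k) (J k) μ < μ.factorial)
    (hkeep : ∀ k, keep k → a (k + 1) (u2 r) = φ k (s k (u2 r)) ∧ (∀ i, i ≠ u2 r → φ k (s k i) = φ k (s k (u2 r)) * a (k + 1) i)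
      ∧ betaS (a (k + 1)) (J (k + 1)) μ ≤ betaS (a (k + 1)) ((Ideal.map (φ k) (J k)).colon {φ k (s k (u2 r)) ^ μ}) μ)
    (hlose : ∀ k, ¬ keep k → a (k + 1) (u1 r) = φ k (s k (u1 r)) ∧ (∀ i, i ≠ u1 r → φ k (s k i) = φ k (s k (u1 r)) * a (k + 1) i)
      ∧ betaS (a (k + 1)) (J (k + 1)) μ ≤ betaS (a (k + 1)) ((Ideal.map (φ k) (J k)).colon {φ k (s k (u1 r)) ^ μ}) μ)
    (k₀ n : ℕ) :
    ((Finset.range n).filter (fun i => keep (k₀ + i))).card ≤ betaS (a k₀) (J k₀) μ :=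
  le_of_add_le_left (keepCount_add_betaS_le_of_betaS_le φ a s J μ keep hgena hgens hdim hJ hne hδ hsa hα hkeep hlose k₀ n)

end Summit.ResolutionOfSingularities.ResolutionOfSingularities.Theorems.PIDim4.PhiLine

end
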